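import Summits.Ventures.QEC.Census.CertCheckBZAutSound
import HarnessLib

/-!
# `bz_aut` assembly, LANE-AGNOSTIC form: the per-block hypothesis is the SEMANTIC block bound
# (director-qec g2 2026-08-27 R15/R16 (e): «type-10 lane-agnostic LowerZ4»)

`bzAut_lower_sound` (`Census/CertCheckBZAutSound.lean`) takes the per-block verdicts in the `bz` lane's Bool form
(`bzBlockOK … b = true`, the Brouwer–Zimmermann enumeration replay). For the `[[144,12,12]]` KERNEL-std programme
two lanes produce block verdicts for the SAME 4-block orbit-cover data — α′ (BZ enumeration, fast leaf) and β
(meet-in-the-middle per block, qec-search-9's checker with its own soundness theorem) — so the assembly is restated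
with the block hypothesis in SEMANTIC form:

  `hblock b : ∀ z ∈ ker Hsyn ∖ rowspace Hstab, label(z) ∈ span W_b → wEff < |z|`,

everything else unchanged (core structural check `bzCoreOK`, weight/label-preserving transports `φ_a` with label
action `ρ_a`, label cover up to transports, parity lift). `blockBound_of_bzBlockOK` is the adapter for the `bz`
lane (one block's Bool verdict ⇒ its semantic bound), so `bzAut_lower_sound` = `bzAut_lower_sound_sem` ∘ adapter.
-/

namespace Summit.Ventures.QEC.Census

open Matrix Literature.InformationTheory.QuantumCodes

section Sem

variable {n : ℕ} {Hsyn Hstab : List ℕ} {rcY rcS : RankCert} {L Ld : List ℕ} {found : List (ℕ × List ℕ)}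
  {wmax : ℕ} {s : BZSide}

/-- **Adapter, `bz` lane**: the side's core check, the allow-list check, the row-count check of block `b` and its
enumeration verdict `bzBlockOK … b = true` give block `b`'s SEMANTIC bound: every non-trivial logical whose label
lies in `span W_b` has weight `> wEff`. -/
theorem blockBound_of_bzBlockOK (hcomm : rowMatrix n Hsyn * (rowMatrix n Hstab)ᵀ = 0)
    (hfound : foundOK Hstab found = true) (hcore : bzCoreOK n Hsyn Hstab rcY rcS L Ld s.evenWitness = true)
    (b : Fin s.blocks.length)
    (hlenb : ((s.blocks[b]).mats.all fun mt => mt.A.length == (gbRows Hstab rcS L (s.blocks[b])).length) = true)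
    (hb : bzBlockOK n Hstab rcS L wmax (found.map Prod.fst) s b = true)
    (z : Fin n → ZMod 2) (hz : rowMatrix n Hsyn *ᵥ z = 0) (hz' : z ∉ rowSpace (rowMatrix n Hstab))
    (hlab : ldMat n L Ld *ᵥ z ∈ Submodule.span (ZMod 2)
      (Set.range fun l : Fin (s.blocks[b]).W.length => ofBits L.length (s.blocks[b]).W[l])) :
    wEff wmax s.evenWitness < hammingNorm z := by
  rcases Nat.eq_zero_or_pos n with hn0 | hn
  · subst hn0
    exfalso
    apply hz'
    have : z = 0 := funext fun i => i.elim0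
    rw [this]
    exact Submodule.zero_mem _
  simp only [bzCoreOK, Bool.and_eq_true, beq_iff_eq] at hcore
  obtain ⟨⟨⟨⟨hY, hS⟩, hL⟩, hdim⟩, -⟩ := hcore
  simp only [bzBlockOK, List.getElem?_eq_getElem b.2] at hb
  have := block_sound hn hcomm hY hS hL hdim hfound (Nat.succ_le_succ (wEff_le wmax s.evenWitness))
    (s.blocks[b]) hb hlenb hz hz' hlab
  omega

/-- **One side, method `bz_aut`, LANE-AGNOSTIC** (CERT-FORMAT v1.1 L6 + §5.4): as `bzAut_lower_sound`, with the
representative blocks' verdicts taken in SEMANTIC form `hblock` (each block's label space forces weight `> wEff`),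
so any certified per-block method (BZ enumeration, meet-in-the-middle, …) plugs in. With the core structural check,
weight/label-preserving transports `φ_a` (label action `ρ_a`) and a label cover up to transports, every
`z ∈ ker Hsyn ∖ rowspace Hstab` has weight `> wmax` (parity-lifted when an even-witness is present). -/
theorem bzAut_lower_sound_sem (hcomm : rowMatrix n Hsyn * (rowMatrix n Hstab)ᵀ = 0)
    (hcore : bzCoreOK n Hsyn Hstab rcY rcS L Ld s.evenWitness = true)
    (hblock : ∀ (b : Fin s.blocks.length) (z : Fin n → ZMod 2), rowMatrix n Hsyn *ᵥ z = 0 →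
      z ∉ rowSpace (rowMatrix n Hstab) → ldMat n L Ld *ᵥ z ∈ Submodule.span (ZMod 2)
        (Set.range fun l : Fin (s.blocks[b]).W.length => ofBits L.length (s.blocks[b]).W[l]) →
      wEff wmax s.evenWitness < hammingNorm z)
    {α : Type*} (φ : α → (Fin n → ZMod 2) → (Fin n → ZMod 2))
    (ρ : α → Matrix (Fin L.length) (Fin L.length) (ZMod 2))
    (hφ : ∀ a (z : Fin n → ZMod 2), rowMatrix n Hsyn *ᵥ z = 0 → z ∉ rowSpace (rowMatrix n Hstab) →
      rowMatrix n Hsyn *ᵥ φ a z = 0 ∧ φ a z ∉ rowSpace (rowMatrix n Hstab) ∧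
        hammingNorm (φ a z) = hammingNorm z ∧ ldMat n L Ld *ᵥ φ a z = ρ a *ᵥ (ldMat n L Ld *ᵥ z))
    (hcover : ∀ lam : Fin L.length → ZMod 2, lam ≠ 0 →
      (∃ b : Fin s.blocks.length, lam ∈ Submodule.span (ZMod 2)
        (Set.range fun l : Fin (s.blocks[b]).W.length => ofBits L.length (s.blocks[b]).W[l])) ∨
      ∃ (a : α) (b : Fin s.blocks.length), ρ a *ᵥ lam ∈ Submodule.span (ZMod 2)
        (Set.range fun l : Fin (s.blocks[b]).W.length => ofBits L.length (s.blocks[b]).W[l]))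
    (w : Fin n → ZMod 2) (hw : rowMatrix n Hsyn *ᵥ w = 0) (hw' : w ∉ rowSpace (rowMatrix n Hstab)) :
    wmax < hammingNorm w := by
  simp only [bzCoreOK, Bool.and_eq_true, beq_iff_eq] at hcore
  obtain ⟨⟨⟨⟨hY, hS⟩, hL⟩, hdim⟩, hpar⟩ := hcore
  let C := CSSCode.ofMatrices (rowMatrix n Hsyn) (rowMatrix n Hstab) hcomm
  have key : wEff wmax s.evenWitness < hammingNorm w :=
    bz_cover C (L := logVec n L) (Ld := ldMat n L Ld) (fun j => mulVec_dual_eq_zero hL j)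
      (fun i j => dual_dotProduct_logVec hL i j) (fun z hz => exists_coeffs_of_ker hcomm hY hS hL hdim hz)
      (fun b : Fin s.blocks.length => ((Submodule.span (ZMod 2) (Set.range fun l : Fin (s.blocks[b]).W.length =>
          ofBits L.length (s.blocks[b]).W[l]) : Submodule (ZMod 2) (Fin L.length → ZMod 2)) : Set _))
      (fun b z hz hz' hlab => hblock b z hz hz' hlab) φ ρ hφ
      (fun lam hlam => by
        rcases hcover lam hlam with ⟨b, hb'⟩ | ⟨a, b, hab⟩
        · exact Or.inl ⟨b, hb'⟩
        · exact Or.inr ⟨a, b, hab⟩)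
      hw hw'
  cases hew : s.evenWitness with
  | none => simpa [wEff, hew] using key
  | some sel =>
    rw [hew] at key hpar
    simp only [parityPartOK] at hpar
    exact lt_hammingNorm_of_even C (fun z hz => even_hammingNorm_of_parityOK hpar hz) hw
      (by simpa [wEff] using key)

end Sem

/-- Control: `bzAut_lower_sound_sem` with the `bz` adapter re-derives the Steane bound (no automorphisms), stated as
`3 ≤ |w|`. -/
theorem steane_bzAut_sem (w : Fin 7 → ZMod 2) (hw : rowMatrix 7 certSteane7.HX *ᵥ w = 0)
    (hw' : w ∉ rowSpace (rowMatrix 7 certSteane7.HZ)) : 3 ≤ hammingNorm w :=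
  have hlen : ∀ b : Fin bzSteane.sideZ.blocks.length, ((bzSteane.sideZ.blocks[b]).mats.all fun mt =>
      mt.A.length == (gbRows certSteane7.HZ bzSteane.rcZ bzSteane.LZ (bzSteane.sideZ.blocks[b])).length) = true := by
    decide
  have hbs : ∀ b : Fin bzSteane.sideZ.blocks.length, bzBlockOK 7 certSteane7.HZ bzSteane.rcZ bzSteane.LZ 2
      (certSteane7.sideZ.found.map Prod.fst) bzSteane.sideZ b = true := by
    decide
  bzAut_lower_sound_sem (rcY := bzSteane.rcX) (rcS := bzSteane.rcZ) (L := bzSteane.LZ) (Ld := bzSteane.LX)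
    (s := bzSteane.sideZ) (comm_of_commOK (by decide)) (by decide)
    (fun b z hz hz' hlab => blockBound_of_bzBlockOK (rcY := bzSteane.rcX) (found := certSteane7.sideZ.found)
      (comm_of_commOK (by decide)) (by decide) (by decide) b (hlen b) (hbs b) z hz hz' hlab)
    (α := Empty) (fun a => a.elim) (fun a => a.elim) (fun a => a.elim)
    (fun lam hlam => Or.inl (exists_block_of_coverOK (by decide) lam hlam)) w hw hw'

end Summit.Ventures.QEC.Census
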